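import Literature.NumberTheory.LFunctions.DirichletPolynomialShortWindows
import Mathlib.NumberTheory.LSeries.Basic
import Mathlib.Analysis.SpecialFunctions.ImproperIntegrals
import Mathlib.MeasureTheory.Integral.ExpDecay
import Mathlib.MeasureTheory.Function.Floor
import HarnessLib

/-!
# Mellin–Plancherel for Dirichlet series with `ℓ¹` coefficients

For a coefficient sequence `a : ℕ → ℂ` with `∑ |a_n| n^{-σ} < ∞` (`σ > 0`) and partial sums
`A(y) = ∑_{n ≤ y} a_n` of polynomial growth `|A(y)| ≤ C y^θ` with `θ < σ`, the function
`φ(u) = e^{-σu} A(e^u)` is in `L¹ ∩ L²(ℝ)`, its Fourier transform is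
`𝓕φ(ξ) = L(σ + 2πiξ)/(σ + 2πiξ)` where `L(s) = ∑ a_n n^{-s}`, and Plancherel gives the
classical identity
`∫_ℝ |A(e^u)|² e^{-2σu} du = (1/2π) ∫_ℝ |L(σ+iy)|²/|σ+iy|² dy`,
i.e. `∫_1^∞ |A(t)|² t^{-1-2σ}… ` in logarithmic coordinates (Montgomery–Vaughan 2007, (5.25)/Thm 5.4
"Plancherel for Mellin transforms"; Granville–Soundararajan 2003, (3.8)).  This is the bridge
between partial sums and mean squares of Dirichlet series on vertical lines used in Halász's
theorem.  Plancherel itself is taken from `Literature.Analysis.FunctionSpaces.PlancherelL1L2`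
(`Literature.Analysis.FunctionSpaces.integral_norm_sq_fourierIntegral_eq`).

## Main results
- `Literature.NumberTheory.LFunctions.MellinPlancherel.psum` : `A(y) = ∑_{1 ≤ n ≤ y} a_n`.
- `Literature.NumberTheory.LFunctions.MellinPlancherel.fourier_phi` : `𝓕φ(ξ) = L(σ + 2πiξ)/(σ + 2πiξ)`.
- `Literature.NumberTheory.LFunctions.MellinPlancherel.integral_norm_sq_psum_exp` :
  `∫ |A(e^u)|² e^{-2σu} du = (1/2π) ∫ |L(σ+iy)|²/|σ+iy|² dy`.

## References
- [MontgomeryVaughan2007] H. L. Montgomery, R. C. Vaughan, *Multiplicative Number Theory I*,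
  §5.1 (Plancherel's identity for Dirichlet series / Mellin transforms).
- [GranvilleSoundararajan2003] A. Granville, K. Soundararajan, *Decay of mean values of
  multiplicative functions*, §3b, (3.8).
-/

noncomputable section

open MeasureTheory Real Complex Finset Set Filter FourierTransform

namespace Literature.NumberTheory.LFunctions

namespace MellinPlancherel

/-- Partial sums `A(y) = ∑_{1 ≤ n ≤ y} a_n`. [folklore] -/
def psum (a : ℕ → ℂ) (y : ℝ) : ℂ := ∑ n ∈ Finset.Icc 1 ⌊y⌋₊, a n

/-- `A(y) = 0` for `y < 1`. [folklore] -/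
theorem psum_of_lt_one (a : ℕ → ℂ) {y : ℝ} (hy : y < 1) : psum a y = 0 := by
  unfold psum
  rcases lt_or_ge y 0 with h | h
  · rw [Nat.floor_of_nonpos h.le]; simp
  · rw [Nat.floor_eq_zero.mpr hy]; simp

/-- `A` is measurable (a step function). [folklore] -/
theorem measurable_psum (a : ℕ → ℂ) : Measurable (psum a) :=
  (measurable_from_nat (f := fun k : ℕ => ∑ n ∈ Finset.Icc 1 k, a n)).comp Nat.measurable_floor

/-- `|A(y)| ≤ ∑_{n ≤ y} |a_n|`. [folklore] -/
theorem norm_psum_le (a : ℕ → ℂ) (y : ℝ) : ‖psum a y‖ ≤ ∑ n ∈ Finset.Icc 1 ⌊y⌋₊, ‖a n‖ :=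
  norm_sum_le _ _

/-- `n ≤ ⌊e^u⌋` iff `log n ≤ u`, for `n ≥ 1`. [folklore] -/
theorem le_floor_exp_iff {n : ℕ} (hn : 1 ≤ n) (u : ℝ) : n ≤ ⌊Real.exp u⌋₊ ↔ Real.log n ≤ u := by
  rw [Nat.le_floor_iff (Real.exp_pos u).le, Real.log_le_iff_le_exp (by exact_mod_cast hn)]

/-- The function `φ(u) = e^{-σu} A(e^u)` (vanishing for `u < 0`). [folklore] -/
def phi (a : ℕ → ℂ) (σ : ℝ) (u : ℝ) : ℂ := (Real.exp (-(σ * u)) : ℂ) * psum a (Real.exp u)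

/-- The pieces `ψ_n(u) = a_n e^{-σu} 1[log n ≤ u]` (`n ≥ 1`). [folklore] -/
def piece (a : ℕ → ℂ) (σ : ℝ) (n : ℕ) : ℝ → ℂ :=
  if 1 ≤ n then (Set.Ici (Real.log n)).indicator (fun u => a n * (Real.exp (-(σ * u)) : ℂ)) else 0

/-- Unfolding of `piece`. [folklore] -/
theorem piece_apply (a : ℕ → ℂ) (σ : ℝ) (n : ℕ) (u : ℝ) :
    piece a σ n u = if 1 ≤ n ∧ Real.log n ≤ u then a n * (Real.exp (-(σ * u)) : ℂ) else 0 := by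
  unfold piece
  by_cases hn : 1 ≤ n
  · simp only [hn, if_true, true_and]
    by_cases hu : Real.log n ≤ u
    · rw [Set.indicator_of_mem (by exact hu), if_pos hu]
    · rw [Set.indicator_of_notMem (by exact hu), if_neg hu]
  · simp [hn]

/-- `piece a σ n u = 0` unless `1 ≤ n ≤ e^u`. [folklore] -/
theorem piece_eq_zero_of_not_mem (a : ℕ → ℂ) (σ : ℝ) (u : ℝ) {n : ℕ}
    (hn : n ∉ Finset.Icc 1 ⌊Real.exp u⌋₊) : piece a σ n u = 0 := by
  rw [piece_apply]
  split_ifs with h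
  · exfalso
    apply hn
    rw [Finset.mem_Icc]
    exact ⟨h.1, (le_floor_exp_iff h.1 u).mpr h.2⟩
  · rfl

/-- `φ(u) = ∑_{n ≤ e^u} piece a σ n u` (finite sum). [folklore] -/
theorem phi_eq_sum (a : ℕ → ℂ) (σ : ℝ) (u : ℝ) :
    phi a σ u = ∑ n ∈ Finset.Icc 1 ⌊Real.exp u⌋₊, piece a σ n u := by
  unfold phi psum
  rw [Finset.mul_sum]
  refine Finset.sum_congr rfl fun n hn => ?_
  rw [Finset.mem_Icc] at hn
  rw [piece_apply, if_pos ⟨hn.1, (le_floor_exp_iff hn.1 u).mp hn.2⟩]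
  ring

/-- `φ(u) = ∑' n, piece a σ n u`. [folklore] -/
theorem phi_eq_tsum (a : ℕ → ℂ) (σ : ℝ) (u : ℝ) : phi a σ u = ∑' n, piece a σ n u := by
  rw [phi_eq_sum, tsum_eq_sum]
  intro n hn
  exact piece_eq_zero_of_not_mem a σ u hn

/-- `‖φ(u)‖ = e^{-σu} ‖A(e^u)‖`. [folklore] -/
theorem norm_phi (a : ℕ → ℂ) (σ : ℝ) (u : ℝ) :
    ‖phi a σ u‖ = Real.exp (-(σ * u)) * ‖psum a (Real.exp u)‖ := by
  unfold phi
  rw [norm_mul, Complex.norm_real, Real.norm_of_nonneg (Real.exp_pos _).le]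

/-- `φ(u) = 0` for `u < 0`. [folklore] -/
theorem phi_of_neg (a : ℕ → ℂ) (σ : ℝ) {u : ℝ} (hu : u < 0) : phi a σ u = 0 := by
  unfold phi
  rw [psum_of_lt_one a (by simpa using Real.exp_lt_one_iff.mpr hu |>.trans_le le_rfl), mul_zero]

/-- `φ` is measurable. [folklore] -/
theorem measurable_phi (a : ℕ → ℂ) (σ : ℝ) : Measurable (phi a σ) := by
  unfold phi
  exact (Complex.measurable_ofReal.comp (by fun_prop)).mul
    ((measurable_psum a).comp Real.measurable_exp)

variable {a : ℕ → ℂ} {σ θ C : ℝ}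

/-- The constant in the growth bound is automatically `≥ 0`. [folklore] -/
theorem const_nonneg (hbd : ∀ y : ℝ, 1 ≤ y → ‖psum a y‖ ≤ C * y ^ θ) : 0 ≤ C := by
  have := hbd 1 le_rfl
  rw [Real.one_rpow, mul_one] at this
  exact (norm_nonneg _).trans this

/-- Pointwise bound `‖φ(u)‖ ≤ C e^{-(σ-θ)u}` for `u ≥ 0` and `= 0` for `u < 0`. [folklore] -/
theorem norm_phi_le (hbd : ∀ y : ℝ, 1 ≤ y → ‖psum a y‖ ≤ C * y ^ θ) (u : ℝ) :
    ‖phi a σ u‖ ≤ (Set.Ici (0 : ℝ)).indicator (fun u => C * Real.exp (-((σ - θ) * u))) u := by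
  rcases lt_or_ge u 0 with hu | hu
  · rw [phi_of_neg a σ hu, norm_zero, Set.indicator_of_notMem (by simpa using hu)]
  · rw [Set.indicator_of_mem (by exact hu), norm_phi]
    have h1 : (1 : ℝ) ≤ Real.exp u := by simpa using Real.one_le_exp hu
    have := hbd _ h1
    rw [← Real.exp_mul] at this
    calc Real.exp (-(σ * u)) * ‖psum a (Real.exp u)‖
        ≤ Real.exp (-(σ * u)) * (C * Real.exp (u * θ)) := by gcongr
      _ = C * Real.exp (-((σ - θ) * u)) := by
          rw [show -((σ - θ) * u) = -(σ * u) + u * θ by ring, Real.exp_add]; ring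

/-- `|φ(u)| ≤ C` under the growth bound `|A(y)| ≤ C y^θ`, `θ < σ`. [folklore] -/
theorem norm_phi_le_const (hbd : ∀ y : ℝ, 1 ≤ y → ‖psum a y‖ ≤ C * y ^ θ) (hθ : θ < σ) (u : ℝ) :
    ‖phi a σ u‖ ≤ C := by
  have hC := const_nonneg hbd
  refine (norm_phi_le hbd u).trans ?_
  rcases lt_or_ge u 0 with hu | hu
  · rw [Set.indicator_of_notMem (by simpa using hu)]; exact hC
  · rw [Set.indicator_of_mem (by exact hu)]
    have : Real.exp (-((σ - θ) * u)) ≤ 1 := by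
      apply Real.exp_le_one_iff.mpr
      nlinarith
    nlinarith

/-- `φ ∈ L¹(ℝ)` under the growth bound `|A(y)| ≤ C y^θ`, `θ < σ`. [folklore] -/
theorem integrable_phi (hbd : ∀ y : ℝ, 1 ≤ y → ‖psum a y‖ ≤ C * y ^ θ) (hθ : θ < σ) :
    Integrable (phi a σ) := by
  have hg : Integrable ((Set.Ici (0 : ℝ)).indicator (fun u => C * Real.exp (-((σ - θ) * u)))) := by
    rw [integrable_indicator_iff measurableSet_Ici]
    rw [integrableOn_Ici_iff_integrableOn_Ioi]
    have h0 : IntegrableOn (fun u : ℝ => C * Real.exp (-(σ - θ) * u)) (Set.Ioi 0) :=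
      (exp_neg_integrableOn_Ioi 0 (b := σ - θ) (by linarith)).const_mul C
    refine IntegrableOn.congr_fun h0 (fun u _ => ?_) measurableSet_Ioi
    show C * Real.exp (-(σ - θ) * u) = C * Real.exp (-((σ - θ) * u))
    rw [neg_mul]
  refine hg.mono' (measurable_phi a σ).aestronglyMeasurable ?_
  exact Filter.Eventually.of_forall (norm_phi_le hbd)

/-- `φ ∈ L²(ℝ)` under the growth bound (bounded and integrable). [folklore] -/
theorem memLp_two_phi (hbd : ∀ y : ℝ, 1 ≤ y → ‖psum a y‖ ≤ C * y ^ θ) (hθ : θ < σ) :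
    MemLp (phi a σ) 2 :=
  Literature.NumberTheory.LFunctions.WindowPlancherel.memLp_two_of_norm_le (integrable_phi hbd hθ) (norm_phi_le_const hbd hθ)

/-! ### The Fourier transform of `φ` -/

/-- `∫ ‖ψ_n‖ = ‖a_n‖ n^{-σ}/σ` (and `0` for `n = 0`). [folklore] -/
theorem integral_norm_piece (hσ : 0 < σ) (n : ℕ) :
    ∫ u, ‖piece a σ n u‖ = if 1 ≤ n then ‖a n‖ * ((n : ℝ) ^ σ)⁻¹ / σ else 0 := by
  unfold piece
  by_cases hn : 1 ≤ n
  · simp only [hn, if_true]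
    rw [show (fun u => ‖(Set.Ici (Real.log n)).indicator (fun u => a n * (Real.exp (-(σ * u)) : ℂ)) u‖) =
        (Set.Ici (Real.log n)).indicator (fun u => ‖a n‖ * Real.exp (-(σ * u))) by
      funext u
      by_cases hu : u ∈ Set.Ici (Real.log n)
      · rw [Set.indicator_of_mem hu, Set.indicator_of_mem hu, norm_mul, Complex.norm_real,
          Real.norm_of_nonneg (Real.exp_pos _).le]
      · rw [Set.indicator_of_notMem hu, Set.indicator_of_notMem hu, norm_zero]]
    rw [integral_indicator measurableSet_Ici, integral_Ici_eq_integral_Ioi, integral_const_mul]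
    have h := integral_exp_mul_Ioi (a := -σ) (by linarith) (Real.log n)
    have h' : ∫ x in Set.Ioi (Real.log n), Real.exp (-(σ * x)) = Real.exp (-σ * Real.log n) / σ := by
      rw [show (fun x => Real.exp (-(σ * x))) = fun x => Real.exp (-σ * x) by funext x; ring_nf, h]
      field_simp
    rw [h', show -σ * Real.log n = Real.log n * (-σ) by ring, Real.exp_mul,
      Real.exp_log (by exact_mod_cast hn), Real.rpow_neg (by positivity)]
    ring
  · simp [hn]

/-- Each `piece a σ n` is integrable (`σ > 0`). [folklore] -/
theorem integrable_piece (hσ : 0 < σ) (n : ℕ) : Integrable (piece a σ n) := by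
  unfold piece
  by_cases hn : 1 ≤ n
  · simp only [hn, if_true]
    rw [integrable_indicator_iff measurableSet_Ici, integrableOn_Ici_iff_integrableOn_Ioi]
    have h0 : IntegrableOn (fun u : ℝ => a n * ((Real.exp (-σ * u) : ℝ) : ℂ)) (Set.Ioi (Real.log n)) :=
      ((integrableOn_exp_mul_Ioi (a := -σ) (by linarith) (Real.log n)).ofReal).const_mul (a n)
    refine IntegrableOn.congr_fun h0 (fun u _ => ?_) measurableSet_Ioi
    show a n * ((Real.exp (-σ * u) : ℝ) : ℂ) = a n * (Real.exp (-(σ * u)) : ℂ)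
    rw [neg_mul]
  · simp only [hn, if_false]
    exact integrable_zero _ _ _

/-- The Fourier transform of one piece: for `n ≥ 1` and `s = σ + 2πiξ`,
`∫ e(-uξ) ψ_n(u) du = a_n n^{-s} / s`. [folklore] -/
theorem fourier_piece (hσ : 0 < σ) {n : ℕ} (hn : 1 ≤ n) (ξ : ℝ) :
    ∫ u : ℝ, (Real.fourierChar (-(u * ξ)) : ℂ) • piece a σ n u =
      LSeries.term a (σ + (2 * π * ξ : ℝ) * I) n / (σ + (2 * π * ξ : ℝ) * I) := by
  set s : ℂ := σ + (2 * π * ξ : ℝ) * I with hs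
  have hsre : s.re = σ := by simp [hs]
  have hs0 : s ≠ 0 := by
    intro h; have := congrArg Complex.re h; rw [hsre] at this; simp at this; linarith
  have hn0 : (n : ℂ) ≠ 0 := by exact_mod_cast (show n ≠ 0 by omega)
  unfold piece
  simp only [hn, if_true]
  -- rewrite the integrand as an indicator of `a n * exp (-s u)`
  have hpt : (fun u : ℝ => (Real.fourierChar (-(u * ξ)) : ℂ) •
      (Set.Ici (Real.log n)).indicator (fun u => a n * (Real.exp (-(σ * u)) : ℂ)) u) =
      (Set.Ici (Real.log n)).indicator (fun u : ℝ => a n * Complex.exp (-s * u)) := by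
    funext u
    by_cases hu : u ∈ Set.Ici (Real.log n)
    · rw [Set.indicator_of_mem hu, Set.indicator_of_mem hu, smul_eq_mul, Real.fourierChar_apply,
        Complex.ofReal_exp]
      rw [show a n * Complex.exp (-s * u) = a n * (Complex.exp (↑(2 * π * -(u * ξ)) * I) *
        Complex.exp (↑(-(σ * u)))) by
        rw [← Complex.exp_add]; congr 2; simp only [hs]; push_cast; ring]
      ring
    · rw [Set.indicator_of_notMem hu, Set.indicator_of_notMem hu, smul_zero]
  rw [hpt, integral_indicator measurableSet_Ici, integral_Ici_eq_integral_Ioi, integral_const_mul,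
    integral_exp_mul_complex_Ioi (by rw [neg_re, hsre]; linarith)]
  -- `exp(-s log n) = n^{-s}`
  have hexp : Complex.exp (-s * (Real.log n : ℝ)) = (n : ℂ) ^ (-s) := by
    rw [Complex.cpow_def_of_ne_zero hn0, ← Complex.ofReal_natCast, ← Complex.ofReal_log (Nat.cast_nonneg n)]
    congr 1; push_cast; ring
  rw [hexp, LSeries.term_of_ne_zero (by omega), Complex.cpow_neg]
  field_simp

variable (hσ : 0 < σ) (hsum : Summable fun n : ℕ => ‖a n‖ / (n : ℝ) ^ σ)
include hσ hsum

/-- `∑_n ∫ |piece a σ n| < ∞` when `∑ |a_n| n^{-σ} < ∞`. [folklore] -/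
theorem summable_integral_norm_piece : Summable fun n => ∫ u, ‖piece a σ n u‖ := by
  simp_rw [integral_norm_piece hσ]
  refine Summable.of_nonneg_of_le (fun n => ?_) (fun n => ?_) (hsum.div_const σ)
  · split_ifs <;> positivity
  · split_ifs with h
    · exact le_of_eq (by rw [div_eq_mul_inv (‖a n‖)])
    · positivity

omit hσ in
/-- `∑ a_n n^{-s}` converges absolutely on `Re s = σ` when `∑ |a_n| n^{-σ} < ∞`. [folklore] -/
theorem LSeriesSummable_of_re_eq {s : ℂ} (hs : s.re = σ) : LSeriesSummable a s := by
  unfold LSeriesSummable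
  refine Summable.of_norm ?_
  refine Summable.of_nonneg_of_le (fun n => norm_nonneg _) (fun n => ?_) hsum
  rcases Nat.eq_zero_or_pos n with rfl | hn
  · simp only [LSeries.term_zero, norm_zero]
    positivity
  · rw [LSeries.term_of_ne_zero hn.ne', norm_div, Complex.norm_natCast_cpow_of_pos hn, hs]

/-- **The Fourier transform of `φ`**: `𝓕φ(ξ) = L(s)/s` with `s = σ + 2πiξ`, where
`L(s) = ∑ a_n n^{-s}`. [folklore] -/
theorem fourier_phi (ξ : ℝ) :
    𝓕 (phi a σ) ξ = LSeries a (σ + (2 * π * ξ : ℝ) * I) / (σ + (2 * π * ξ : ℝ) * I) := by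
  rw [Real.fourier_real_eq]
  have h1 : (fun v : ℝ => (Real.fourierChar (-(v * ξ))) • phi a σ v) =
      fun v : ℝ => ∑' n, (Real.fourierChar (-(v * ξ)) : ℂ) • piece a σ n v := by
    funext v
    rw [phi_eq_tsum, Circle.smul_def, smul_eq_mul, ← tsum_mul_left]
    rfl
  rw [h1, ← integral_tsum_of_summable_integral_norm]
  · rw [LSeries, ← tsum_div_const]
    refine tsum_congr fun n => ?_
    rcases Nat.eq_zero_or_pos n with rfl | hn
    · simp [piece]
    · exact fourier_piece hσ hn ξ
  · intro n
    have hb : MemLp (fun v : ℝ => (Real.fourierChar (-(v * ξ)) : ℂ)) ⊤ volume := by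
      refine memLp_top_of_bound (by fun_prop) 1 (Filter.Eventually.of_forall fun v => ?_)
      simp
    refine ((integrable_piece (a := a) hσ n).smul_of_top_left hb).congr
      (Filter.Eventually.of_forall fun v => ?_)
    simp only [Pi.smul_apply', smul_eq_mul]
    ring
  · refine (summable_integral_norm_piece hσ hsum).congr fun n => ?_
    refine integral_congr_ae (Filter.Eventually.of_forall fun v => ?_)
    simp only [norm_smul, Circle.norm_coe, one_mul]

/-- **Mellin–Plancherel**: for `ℓ¹`-weighted coefficients (`∑ |a_n| n^{-σ} < ∞`, `σ > 0`) whose partial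
sums satisfy `|A(y)| ≤ C y^θ` (`y ≥ 1`) for some `θ < σ`,
`∫ |A(e^u)|² e^{-2σu} du = (1/2π) ∫ |L(σ+iy)|²/|σ+iy|² dy`. [folklore] -/
theorem integral_norm_sq_psum_exp (hθ : θ < σ) (hbd : ∀ y : ℝ, 1 ≤ y → ‖psum a y‖ ≤ C * y ^ θ) :
    ∫ u : ℝ, ‖psum a (Real.exp u)‖ ^ 2 * Real.exp (-(2 * σ * u)) =
      (1 / (2 * π)) * ∫ y : ℝ, ‖LSeries a (σ + y * I)‖ ^ 2 / ‖(σ : ℂ) + y * I‖ ^ 2 := by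
  have hP := Literature.Analysis.FunctionSpaces.integral_norm_sq_fourierIntegral_eq (integrable_phi hbd hθ) (memLp_two_phi hbd hθ)
  -- right-hand side of Plancherel
  have hR : ∫ u : ℝ, ‖phi a σ u‖ ^ 2 = ∫ u : ℝ, ‖psum a (Real.exp u)‖ ^ 2 * Real.exp (-(2 * σ * u)) := by
    refine integral_congr_ae (Filter.Eventually.of_forall fun u => ?_)
    simp only [norm_phi]
    rw [mul_pow, ← Real.exp_nat_mul]
    ring_nf
  -- left-hand side of Plancherel
  set G : ℝ → ℝ := fun y => ‖LSeries a (σ + y * I)‖ ^ 2 / ‖(σ : ℂ) + y * I‖ ^ 2 with hG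
  have hL : ∫ ξ : ℝ, ‖𝓕 (phi a σ) ξ‖ ^ 2 = ∫ ξ : ℝ, G ((2 * π) * ξ) := by
    refine integral_congr_ae (Filter.Eventually.of_forall fun ξ => ?_)
    simp only [hG]
    rw [fourier_phi hσ hsum, norm_div, div_pow]
  have h2π : |(2 * π)⁻¹| = 1 / (2 * π) := by rw [abs_of_pos (by positivity), one_div]
  rw [← hR, ← hP, hL, Measure.integral_comp_mul_left G, h2π, smul_eq_mul]

end MellinPlancherel

end Literature.NumberTheory.LFunctions
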